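import Summits.BirchSwinnertonDyer.BirchSwinnertonDyer.Theorems.ManinLocalTwoThreeManinConstantTwoHundredEightC
import Summits.BirchSwinnertonDyer.BirchSwinnertonDyer.Theorems.ManinLocalTwoThreeRootFormOneHundredFour
import Summits.BirchSwinnertonDyer.BirchSwinnertonDyer.Theorems.ManinLocalTwoThreeTwistDefectRootLevel
import Summits.BirchSwinnertonDyer.BirchSwinnertonDyer.Theorems.ByReductionTypeAtTwoAdditivePotGoodPrintZhaiIrreducibleInstancesA
import Summits.BirchSwinnertonDyer.Rank1Residual.Additive.IntModelConductorCertificate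
import Literature.NumberTheory.EllipticCurves.CuspFormTwist
import Literature.NumberTheory.EllipticCurves.QuadraticTwistNegOneLFunctionProofs
import HarnessLib

/-!
# Level 208: THE ROW `208b = φ₁₀₄ ⊗ χ₋₄` and `|c| = 1` ON THAT CLASS — UNCONDITIONALLY (aligned `χ₋₄`-transport from the root `104a`)

Cell bsd-f2-manin, route `ManinLocalTwoThree` (crux C2 `ManinOddAtFour`, stmt-BirchSwinnertonDyer-22967; `--supports` helper), LEAD p1 gen 26.
The companion of `…ManinConstantTwoHundredEightC` (row `c = 52a ⊗ χ₋₄`): here the second surviving certificate `208b` (`d′ = 160`) of an g55's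
`…PinningTwoHundredEight`, root `φ₁₀₄ = F104cusp` (`…RootFormOneHundredFour`: datum-free cusp form of level 104, table `cF` to depth 170, `a₂ₖ = 0`,
squeeze into the Néron lattice of `104a1` from p2 g31's Bracket–Sturm certificate).

* §1 THE ROW: on the certificate `208b`, **`D.f = charTwist 208 (104 ∣ 208) (4² ∣ 208) χ₄ φ₁₀₄`** (kernel identity `160·χ₄(n)·aₙ(φ₁₀₄) = Σ_j y_j·tabs_j[n]`, `n < 128`);
  the class is singled out by `(a₃(W), a₅(W)) = (−1, −1)` (rows `a, b, c, d` have `(−1,−3), (−1,−1), (0,2), (3,−1)`).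
* §2 THE ALIGNED EDGE `104a1 ⊗ (−1) = 208b1 = [0,−1,0,−16,32]` (`u = 1`, `r = 1`), `208b1` elliptic and globally minimal (`2¹¹ ∥ Δ`).
* §3 **`abs_maninConstant_eq_one_twoHundredEight_of_lFunction_three_five (D) (h3 : W.LFunction 3 = -1) (h5 : W.LFunction 5 = -1) (hopt) : |D.maninConstant| = 1`**,
  and, with `…TwoHundredEightC`, **`abs_maninConstant_eq_one_twoHundredEight_of_rowBC`**: `|c| = 1` on BOTH classes `208b, 208c` — i.e. for every
  lattice-optimal `X₀(208)`-datum whose curve has `a₃(W) ∈ {0}` or `(a₃, a₅) = (−1, −1)`.  Rows `a, d` (`26a/26b ⊗ χ₋₄`) stay OPEN (no level-26 root in the tree).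

HONEST FRAMING: unconditional (standard axioms); two of the four classes of level 208; nothing here proves C2/C3, Manin's conjecture or BSD.
[cite: CremonaAlgorithms1997, §2.10, Table 1 (208b1, 104a1)] [cite: Shimura1971, Prop. 3.64] [cite: Stevens1989, Lemma (5.4) p. 97] [cite: Pal2012, Lemma 3.1]
[cite: AgasheRibetStein2006, §§1–2] [cite: SilvermanAEC2009, VII.1 Remark 1.1]
-/

set_option autoImplicit false
-- lint-debt: the directory name repeats the summit name (sibling precedent `ManinLocalTwoThreeManinConstantTwoHundredEightC.lean`)
set_option linter.dupNamespace false

noncomputable section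

open Complex WeierstrassCurve
open UpperHalfPlane hiding I
open scoped MatrixGroups ModularForm
open ModularForm CongruenceSubgroup PowerSeries
open Literature.NumberTheory.ModularForms
open Literature.NumberTheory.EllipticCurves Literature.NumberTheory.EllipticCurves.ModularForms

namespace Summit.BirchSwinnertonDyer.BirchSwinnertonDyer.Theorems.ManinLocalTwoThree.LevelTwoHundredEight

open Summit.BirchSwinnertonDyer.BirchSwinnertonDyer.Theorems.ManinLocalTwoThree
open Summit.BirchSwinnertonDyer.Rank1Residual.Additive
open BracketSturm PinningKernel PinningTwoHundredEight RootFormOneHundredFour LevelOneHundredFour TwistDefect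

set_option maxHeartbeats 4000000
set_option maxRecDepth 16384

variable {W : WeierstrassCurve ℚ} [W.IsElliptic]

/-! ## §1 The row `208b = φ₁₀₄ ⊗ χ₋₄` -/

/-- `χ₄(n)·aₙ(φ₁₀₄)` to depth `128` — the row `208b`. [cite: CremonaAlgorithms1997, Table 1 (208b)] -/
def tabTb : List ℤ :=
  [0, 1, 0, -1, 0, -1, 0, -5, 0, -2, 0, 2, 0, -1, 0, 1, 0, -3, 0, 2, 0, 5, 0, -4, 0, -4, 0, 5, 0, -6, 0, 4, 0, -2, 0, 5, 0, 11, 0, 1, 0, 8, 0, 1, 0, 2, 0, -9, 0, 18, 0, 3, 0, -12, 0, -2, 0,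
  -2, 0, -6, 0, 0, 0, 10, 0, 1, 0, -6, 0, 4, 0, -7, 0, -2, 0, 4, 0, -10, 0, -12, 0, 1, 0, 16, 0, 3, 0, 6, 0, -10, 0, 5, 0, -4, 0, -2, 0, -10, 0, -4, 0, 4, 0, 8, 0, -5, 0, -20, 0, -5, 0,
  -11, 0, 2, 0, 4, 0, 2, 0, 15, 0, -7, 0, -8, 0, 9, 0, 8]

/-- The twist identity `tabTb[n] = χ₄(n)·cF[n]`, `n < 128`. [folklore] -/
theorem hTwB : ∀ n < 128, tabTb.getD n 0 = ZMod.χ₄ n * cF.getD n 0 := by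
  decide +kernel

/-- **Row identity `208b`**: `160·tabTb[n] = Σ_j y_j·tabs_j[n]`, `n < 128`. [folklore] -/
theorem hrowB : ∀ n < 128, rowB.2.1 * tabTb.getD n 0 = ∑ j : Fin 34, rowB.2.2.getD (j : ℕ) 0 * (tabs j).getD n 0 := by
  decide +kernel

/-- `aₙ(φ₁₀₄ ⊗ χ₋₄) = tabTb[n]`, `n < 128`, read in `M₂(Γ₀(208))`. [cite: Shimura1971, Prop. 3.64] -/
theorem tabTb_eq_modCoef : ∀ n < 128, ((tabTb.getD n 0 : ℤ) : ℂ) = modCoefₗ 208 2 n (ModularFormClass.modularForm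
    (charTwist 208 (⟨2, rfl⟩ : 104 ∣ 208) (⟨13, rfl⟩ : 4 ^ 2 ∣ 208) isQuadratic_χ₄_ringHomComp F104cusp)) := by
  intro n hn
  have hc : ((tabTb.getD n 0 : ℤ) : ℂ) = ((ZMod.χ₄ n : ℤ) : ℂ) * ((cF.getD n 0 : ℤ) : ℂ) := by exact_mod_cast hTwB n hn
  rw [modCoefₗ_modularForm, cuspCoeff_charTwist 208 _ _ isQuadratic_χ₄_ringHomComp isPrimitive_χ₄_ringHomComp,
    χ₄_ringHomComp_apply_natCast, ← cF_eq_cuspCoeff n (by omega)]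
  exact hc

/-- **LEVEL 208: THE ROW `b`.**  On the second certificate (`208b`) the newform of an `X₀(208)`-datum is the EXPLICIT twist `φ₁₀₄ ⊗ χ₋₄`.
[cite: CremonaAlgorithms1997, §2.10, Table 1 (208a–d)] [cite: Shimura1971, Prop. 3.64] -/
theorem f_cases_rowB (D : ModularParametrizationData W 208) :
    truth W [2, 3, 5, 7, 11, 13, 17, 19, 23, 29, 31] = rowA.1 ∨
    (truth W [2, 3, 5, 7, 11, 13, 17, 19, 23, 29, 31] = rowB.1 ∧
      D.f = charTwist 208 (⟨2, rfl⟩ : 104 ∣ 208) (⟨13, rfl⟩ : 4 ^ 2 ∣ 208) isQuadratic_χ₄_ringHomComp F104cusp) ∨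
    truth W [2, 3, 5, 7, 11, 13, 17, 19, 23, 29, 31] = rowC.1 ∨ truth W [2, 3, 5, 7, 11, 13, 17, 19, 23, 29, 31] = rowD.1 := by
  haveI : FiniteDimensional ℂ (ModularForm (Gamma0 208) 2) := Module.finite_of_finrank_eq_succ finrank_modularForm_two
  have hlen : ∀ i : Fin 34, (duals i).length ≤ 128 := by decide +kernel
  have stages_map_fst : stages.map Prod.fst = [2, 3, 5, 7, 11, 13, 17, 19, 23, 29, 31] := by decide
  obtain ⟨C, hC, c, hc, htruth, hpin⟩ := pinning D
  have ht := tables_of_etaCertsSparse 208 128 (fun i : Fin 34 ↦ expFn (Ls[(i : ℕ)]).1) (fun i ↦ shifts i) tabs C hC hshift hcert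
  rw [stages_map_fst] at htruth
  rw [goodCerts_eq_rows] at hc
  simp only [List.mem_cons, List.mem_nil_iff, or_false] at hc
  rcases hc with rfl | rfl | rfl | rfl
  · exact Or.inl htruth
  · exact Or.inr (Or.inl ⟨htruth, cuspForm_eq_of_modularForm_eq (eq_of_smul_eq_sum_of_row C tabs duals 367810560 ht hlen hdual
      (by norm_num) finrank_modularForm_two _ tabTb tabTb_eq_modCoef rowB.2.1 (by decide) rowB.2.2 hpin hrowB)⟩)
  · exact Or.inr (Or.inr (Or.inl htruth))
  · exact Or.inr (Or.inr (Or.inr htruth))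

omit [W.IsElliptic] in
/-- `a₅(W)` read off a truth row. [folklore] -/
theorem lFunction_five_of_truth (row : List (ℕ × ℤ) × ℤ × List ℤ) (h : truth W [2, 3, 5, 7, 11, 13, 17, 19, 23, 29, 31] = row.1) :
    W.LFunction 5 = (row.1.getD 2 (0, 0)).2 := by
  have h' := congrArg (fun l : List (ℕ × ℤ) ↦ (l.getD 2 (0, 0)).2) h
  simpa [truth] using h'

/-- **The `208b` row selected by `(a₃(W), a₅(W)) = (−1, −1)`**: `D.f = φ₁₀₄ ⊗ χ₋₄`. [cite: CremonaAlgorithms1997, Table 1 (208b)] -/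
theorem f_eq_charTwist_F104_of_lFunction_three_five (D : ModularParametrizationData W 208) (h3 : W.LFunction 3 = -1) (h5 : W.LFunction 5 = -1) :
    D.f = charTwist 208 (⟨2, rfl⟩ : 104 ∣ 208) (⟨13, rfl⟩ : 4 ^ 2 ∣ 208) isQuadratic_χ₄_ringHomComp F104cusp := by
  rcases f_cases_rowB D with h | ⟨-, hf⟩ | h | h
  · have h' := lFunction_five_of_truth rowA h; rw [h5] at h'; simp [rowA] at h'
  · exact hf
  · have h' := lFunction_three_of_truth rowC h; rw [h3] at h'; simp [rowC] at h'
  · have h' := lFunction_three_of_truth rowD h; rw [h3] at h'; simp [rowD] at h'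

/-- The coefficient row on `208b`: `aₙ(D.f) = χ₄(n)·aₙ(φ₁₀₄)`. [cite: Shimura1971, Prop. 3.64] -/
theorem cuspCoeff_f_of_lFunction_three_five (D : ModularParametrizationData W 208) (h3 : W.LFunction 3 = -1) (h5 : W.LFunction 5 = -1) :
    ∀ n : ℕ, ¬ 2 ∣ n → cuspCoeff D.f n = (ZMod.χ₄ n : ℂ) * cuspCoeff F104cusp n := by
  intro n _
  rw [f_eq_charTwist_F104_of_lFunction_three_five D h3 h5, cuspCoeff_charTwist 208 _ _ isQuadratic_χ₄_ringHomComp isPrimitive_χ₄_ringHomComp,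
    χ₄_ringHomComp_apply_natCast]

/-! ## §2 The aligned edge `104a1 ⊗ (−1) = 208b1` -/

/-- **ALIGNED EDGE `104a1 ⊗ (−1) = 208b1 = [0, −1, 0, −16, 32]`** (`u = 1`). [cite: CremonaAlgorithms1997, Table 1 (104a1, 208b1)] -/
theorem smul_quadraticTwist_oneHundredFourA1_negOne :
    (1 : VariableChange ℚ) • (⟨0, 1, 0, -16, -32⟩ : WeierstrassCurve ℚ).quadraticTwist (-1) = ⟨0, -1, 0, -16, 32⟩ := by
  rw [one_smul]
  ext <;> simp only [quadraticTwist_a₁, quadraticTwist_a₂, quadraticTwist_a₃, quadraticTwist_a₄, quadraticTwist_a₆, b₂, b₄, b₆] <;> norm_num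

/-- `Δ(208b1) = Δ(104a1)` (`r = 1`). [folklore] -/
theorem Δ_twoHundredEightB1_eq : (((1 : ℤ)) : ℚ) ^ 12 * (⟨0, -1, 0, -16, 32⟩ : WeierstrassCurve ℚ).Δ = (⟨0, 1, 0, -16, -32⟩ : WeierstrassCurve ℚ).Δ := by
  norm_num [WeierstrassCurve.Δ, WeierstrassCurve.b₂, WeierstrassCurve.b₄, WeierstrassCurve.b₆, WeierstrassCurve.b₈]

/-- `208b1` is an elliptic curve (`Δ = −2¹¹·13`). [folklore] -/
theorem isElliptic_twoHundredEightB1 : (⟨0, -1, 0, -16, 32⟩ : WeierstrassCurve ℚ).IsElliptic :=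
  ⟨by norm_num [WeierstrassCurve.Δ, WeierstrassCurve.b₂, WeierstrassCurve.b₄, WeierstrassCurve.b₆, WeierstrassCurve.b₈]⟩

/-- **`208b1` is globally minimal** (kernel certificate: `2¹¹ ∥ Δ`, `13 ∤ c₄ = 784`). [cite: SilvermanAEC2009, VII.1 Remark 1.1] -/
theorem isGloballyMinimal_twoHundredEightB1 : (⟨0, -1, 0, -16, 32⟩ : WeierstrassCurve ℚ).IsGloballyMinimal := by
  rw [show (⟨0, -1, 0, -16, 32⟩ : WeierstrassCurve ℚ) = ⟨((0 : ℤ) : ℚ), ((-1 : ℤ) : ℚ), ((0 : ℤ) : ℚ), ((-16 : ℤ) : ℚ), ((32 : ℤ) : ℚ)⟩ by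
    ext <;> norm_num]
  exact IntModelCond.isGloballyMinimal_mk_of_minCheck 0 (-1) 0 (-16) 32 (cm := ⟨11, 4, 6, [⟨13, 3, 1, 0, 0⟩]⟩) (by decide +kernel)

/-! ## §3 `|c| = 1` on the class `208b`, and on `208b ∪ 208c` -/

/-- **`|c| = 1` ON THE CLASS `208b`, UNCONDITIONALLY** (curves with `(a₃, a₅) = (−1, −1)`).  Root squeeze `Λ(φ₁₀₄) ⊆ Λ_Néron(104a1)`, `a₂ₖ(φ₁₀₄) = 0`,
aligned edge to `208b1`, desc's `χ₋₄` squeeze transport. [cite: Stevens1989, Lemma (5.4) p. 97] [cite: Pal2012, Lemma 3.1] [cite: AgasheRibetStein2006, §§1–2] -/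
theorem abs_maninConstant_eq_one_twoHundredEight_of_lFunction_three_five (W : WeierstrassCurve ℚ) [W.IsElliptic] [W.IsGloballyMinimal]
    (D : ModularParametrizationData W 208) (h3 : W.LFunction 3 = -1) (h5 : W.LFunction 5 = -1)
    (hopt : ∀ z ∈ D.L.lattice, ∃ w ∈ periodLattice D.f, z = D.c * w) : |D.maninConstant| = 1 := by
  haveI := AddPotGoodPrint.isElliptic_104A1
  haveI := isElliptic_twoHundredEightB1
  haveI := isGloballyMinimal_twoHundredEightB1
  obtain ⟨L₀, h2, h3'⟩ := ((⟨0, 1, 0, -16, -32⟩ : WeierstrassCurve ℚ).baseChange ℂ).exists_periodPair_of_isElliptic'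
  have hL₀ : IsNeronLatticeOf ((⟨0, 1, 0, -16, -32⟩ : WeierstrassCurve ℚ).baseChange ℂ) L₀ := ⟨h2, h3'⟩
  exact abs_maninConstant_eq_one_of_squeeze_negOneTwist_aligned_level (⟨26, rfl⟩ : 4 ∣ 104) (⟨2, rfl⟩ : 104 ∣ 208) (⟨13, rfl⟩ : 4 ^ 2 ∣ 208)
    F104cusp (⟨0, 1, 0, -16, -32⟩ : WeierstrassCurve ℚ) L₀ hL₀ (periodLattice_le_F104cusp L₀ hL₀) cuspCoeff_even_F104cusp
    (C := ⟨0, -1, 0, -16, 32⟩) 1 smul_quadraticTwist_oneHundredFourA1_negOne (r := 1) (Or.inl rfl) Δ_twoHundredEightB1_eq W D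
    (cuspCoeff_f_of_lFunction_three_five D h3 h5) hopt

/-- **`|c| = 1` ON `208b ∪ 208c`**: for every globally minimal elliptic `W/ℚ` whose `X₀(208)`-datum lies on the certificate `b` or `c` — i.e. NOT on
`208a` (`a₅ = −3`) nor `208d` (`a₃ = 3`) — the Manin constant is `±1`.  (The two remaining classes are `26a/26b ⊗ χ₋₄`.) [cite: AgasheRibetStein2006, §§1–2] -/
theorem abs_maninConstant_eq_one_twoHundredEight_of_rowBC (W : WeierstrassCurve ℚ) [W.IsElliptic] [W.IsGloballyMinimal]
    (D : ModularParametrizationData W 208) (ha : W.LFunction 5 ≠ -3) (hd : W.LFunction 3 ≠ 3)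
    (hopt : ∀ z ∈ D.L.lattice, ∃ w ∈ periodLattice D.f, z = D.c * w) : |D.maninConstant| = 1 := by
  rcases f_cases_rowB D with h | ⟨h, -⟩ | h | h
  · exact absurd (lFunction_five_of_truth rowA h) (by simpa [rowA] using ha)
  · exact abs_maninConstant_eq_one_twoHundredEight_of_lFunction_three_five W D (by simpa [rowB] using lFunction_three_of_truth rowB h)
      (by simpa [rowB] using lFunction_five_of_truth rowB h) hopt
  · exact abs_maninConstant_eq_one_twoHundredEight_of_lFunction_three_eq_zero W D (by simpa [rowC] using lFunction_three_of_truth rowC h) hopt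
  · exact absurd (lFunction_three_of_truth rowD h) (by simpa [rowD] using hd)

/-- **`2 ∤ c` on `208b ∪ 208c`.** [cite: AgasheRibetStein2006, §§1–2] -/
theorem not_two_dvd_maninConstant_twoHundredEight_of_rowBC (W : WeierstrassCurve ℚ) [W.IsElliptic] [W.IsGloballyMinimal]
    (D : ModularParametrizationData W 208) (ha : W.LFunction 5 ≠ -3) (hd : W.LFunction 3 ≠ 3)
    (hopt : ∀ z ∈ D.L.lattice, ∃ w ∈ periodLattice D.f, z = D.c * w) : ¬ (2 : ℤ) ∣ D.maninConstant := by
  intro h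
  have h1 := abs_maninConstant_eq_one_twoHundredEight_of_rowBC W D ha hd hopt
  have := Int.le_of_dvd (by rw [h1]; norm_num) ((dvd_abs _ _).mpr h)
  rw [h1] at this
  norm_num at this

end Summit.BirchSwinnertonDyer.BirchSwinnertonDyer.Theorems.ManinLocalTwoThree.LevelTwoHundredEight

end
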